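/-
Copyright (c) 2026 the pub-hodgecm-mathlib formalisation cell (harness21).  Prover seat hodgecm-mathlib-K2Liu-p08 (g5), Track B «K2-LIT»,
#184♮ = hLiu418 = `stmt-HodgeConjecture-24832`; #42S organ S1 (vii): THE NON-SPLIT FACE OF RECORD `hS1ns` — CLOSED, ZERO HYPOTHESES.
-/
import Summits.HodgeConjecture.HodgeConjecture.Theorems.K2LiuLocalSWSpanningNonsplitFaceClosed       -- ★ the dispatch `hS1ns_of_branches` (p08)
import Summits.HodgeConjecture.HodgeConjecture.Theorems.K2LiuLocalSWSpanningInertFaceOfRecord      -- ★∕📤 the inert-unramified branch at the record (p08 over K2Liu-p01 ED. 4)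
import Summits.HodgeConjecture.HodgeConjecture.Theorems.K2LiuLocalSWSpanningRamifiedFaceOfRecord   -- ★ the ramified branch at the record (p08 over F0P2-p07's core)
import HarnessLib

/-!
# Crux `HLiu418`, #42S organ S1 (vii): THE NON-SPLIT FACE OF RECORD `hS1ns` — CLOSED

Cell `hodgecm-mathlib`, crux item hLiu418 = `stmt-HodgeConjecture-24832`; squad K2 ∕ K2Liu; LEAD F0P6-plan (g15); S1 DESK LH7-p08 (g2); prover K2Liu-p08 (g5).
THEOREMS ONLY (no `def`, no instance, no notation, no named-fact hypothesis, no `sorry`); lane `--supports stmt-HodgeConjecture-24832 --as helper`.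

WHAT.  **`hS1ns_of_record : ‹the hS1ns binder of ★ K2LiuStandardSectionSpanBySWGeneratorsEndGuarded.standardSectionSpanBySWGenerators_of_S1_S5_guarded,
bytes ll. 61–80 VERBATIM›`** with ZERO hypotheses: ★ `K2LiuLocalSWSpanningNonsplitFaceClosed.hS1ns_of_branches` fed with ★∕📤
`K2LiuLocalSWSpanningInertFaceOfRecord.hS1ns_inert_of_record` (inert-unramified branch: K2Liu-p01's ED. 4 ★ `…InertFaceFinal` re-keyed at the record) and ★
`K2LiuLocalSWSpanningRamifiedFaceOfRecord.localDegPS_le_sup_localSWImage_ramified_of_record` (ramified branch: F0P2-p07's ★ `…RamifiedCore` re-keyed at the record).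
Together with ★ `K2LiuLocalSWSpanningSplitFaceClosed.hS1sp_of_record`, BOTH S1 binders of the #42S END head are now names with no arguments.
References: [Kudla1994] §3 Thm. 3.1; [KudlaSweet1997] §1 Thm. 1.2; [HarrisKudlaSweet1996] §6 Prop. 6.2, 6.4; [GanQiuTakeda2014] §6.4 Prop. 15.
HONEST LABEL.  Count-neutral helper: `HC_CM` is proved only modulo the 7 printed citations (2 remaining named inputs: hLiu418 = `stmt-HodgeConjecture-24832`,
h413 = `stmt-HodgeConjecture-24833`) until rung 0 closes.  The END tie (replacing `hS1ns hS1sp` by these names) is the END owner's ∕ tie desk's.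

## References
* [Kudla1994] S. S. Kudla, Israel J. Math. 87 (1994), §3 Thm. 3.1.  * [KudlaSweet1997] S. Kudla, W. J. Sweet, Israel J. Math. 98 (1997), §1.
* [HarrisKudlaSweet1996] M. Harris, S. Kudla, W. J. Sweet, J. Amer. Math. Soc. 9 (1996), §6.  * [GanQiuTakeda2014] W. T. Gan, Y. Qiu, S. Takeda, Invent. Math. 198 (2014).
-/

set_option autoImplicit false
set_option linter.dupNamespace false -- the mandated namespace repeats `HodgeConjecture.HodgeConjecture`

noncomputable section

open scoped Matrix
open NumberField IsDedekindDomain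
open Literature.RepresentationTheory.HeisenbergGroup
open Literature.NumberTheory.QuadraticForms
open Literature.NumberTheory.Automorphic Literature.NumberTheory.Automorphic.UnitaryGroup Literature.NumberTheory.GaloisRepresentations
open Literature.NumberTheory.Weil1964 Literature.RepresentationTheory.HarrisKudlaSweet1996
open Literature.NumberTheory.GelbartRogawski1991 Literature.NumberTheory.GelbartRogawski1991.GRConstruction Literature.NumberTheory.GelbartRogawski1991.UnitaryDualPair
open Literature.NumberTheory.GelbartRogawski1991.UnitaryDualPair.LocalSplitting
open Literature.NumberTheory.K2Lit.SiegelDoubled Literature.NumberTheory.K2Lit.LocalSiegelDoubled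
open Summit.HodgeConjecture.HodgeConjecture.Cruxes.HLiu418.K2LiuLocalSWSectionDefs Summit.HodgeConjecture.HodgeConjecture.Cruxes.HLiu418.K2LiuLocalSWImageDefs
open Summit.HodgeConjecture.HodgeConjecture.Cruxes.HLiu418.K2LiuSWSectionPlaceFactorisation
open Summit.HodgeConjecture.HodgeConjecture.Cruxes.HLiu418.K2LiuLocalSWSpanningNonsplitFaceClosed
open Summit.HodgeConjecture.HodgeConjecture.Cruxes.HLiu418.K2LiuLocalSWSpanningInertFaceOfRecord
open Summit.HodgeConjecture.HodgeConjecture.Cruxes.HLiu418.K2LiuLocalSWSpanningRamifiedFaceOfRecord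

namespace Summit.HodgeConjecture.HodgeConjecture.Cruxes.HLiu418.K2LiuLocalSWSpanningNonsplitFaceOfRecord

set_option maxHeartbeats 800000 in -- MEASURED: as ★ `hS1ns_of_branches` (the END head's telescope in the statement)
open scoped Classical in
/-- **`hS1ns` OF THE #42S END HEAD, ZERO HYPOTHESES** — the binder bytes ll. 61–80 VERBATIM: ★ `hS1ns_of_branches` ∘ (★∕📤 `hS1ns_inert_of_record`, ★
`localDegPS_le_sup_localSWImage_ramified_of_record`). [cite: Kudla1994, §3 Thm. 3.1] [cite: KudlaSweet1997, §1 Thm. 1.2] [cite: HarrisKudlaSweet1996, §6 Prop. 6.2, 6.4] -/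
theorem hS1ns_of_record :
    ∀ (L : Type) [Field L] [NumberField L] [IsCMField L] (e : Fin 2 × Fin 1 ≃ Fin 2)
      (dV : Fin 2 → L) (hdV : ∀ i, IsCMField.complexConj L (dV i) = dV i) (hdV0 : ∀ i, dV i ≠ 0)
      (dW : Fin 1 → L) (hdW : ∀ i, IsCMField.complexConj L (dW i) = dW i) (hdW0 : ∀ i, dW i ≠ 0)
      {M' n' : ℕ} (eW : Fin 1 × Fin 3 ≃ Fin M') (e' : Fin 2 × Fin M' ≃ Fin n')
      (dV₀ : Fin 3 → L) (hdV₀ : ∀ k, IsCMField.complexConj L (dV₀ k) = dV₀ k) (hdV₀0 : ∀ k, dV₀ k ≠ 0)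
      (χb : HeckeCharacter L) (hχbs : IsSplittingChar L 1 χb),
      ∀ (v : HeightOneSpectrum (𝓞 (Fp L))) (c₁ : (Fp L)ˣ) (dV₁ : Fin 3 → L) (hdV₁ : ∀ k, IsCMField.complexConj L (dV₁ k) = dV₁ k) (hdV₁0 : ∀ k, dV₁ k ≠ 0),
      (∀ k, dV₁ k = ((c₁ : Fp L) : L) * dV₀ k) → ¬ IsSquare (algebraMap (Fp L) (v.adicCompletion (Fp L)) (cmQuadraticGenerator L : Fp L)) → hilbertSymbol (v.adicCompletion (Fp L)) (algebraMap (Fp L) _ ((c₁ : (Fp L)ˣ) : Fp L)) (algebraMap (Fp L) _ (cmQuadraticGenerator L : Fp L)) = -1 →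
      localDegPS (Fp L) L (IsCMField.complexConj L) (complexConj_imagUnit L) (imagUnit_ne_zero L) (imagUnit_mul_self L)
          v 2 (gramR_isSymm L e dV hdV dW hdW) (hermD_eq_map_gramD L e dV hdV dW hdW) (fun w => (χb ^ 3).localComponent w.1) ((((3 : ℕ) : ℂ) - ((2 : ℕ) : ℂ)) / 2) ≤
        localSWImage L e dV hdV dW hdW eW e' dV₀ hdV₀ v ((finSplittings L e' dV hdV hdV0 (tensorFrame L dW eW dV₀) (tensorFrame_real L dW hdW eW dV₀ hdV₀) (tensorFrame_ne_zero L dW eW dV₀ hdW0 hdV₀0) χb (borelPlaceMeasure L) (cmFinLocalFamily L e' dV hdV hdV0 (tensorFrame L dW eW dV₀) (tensorFrame_real L dW hdW eW dV₀ hdV₀) (tensorFrame_ne_zero L dW eW dV₀ hdW0 hdV₀0) χb hχbs (borelPlaceMeasure L))).s v)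
          ⟨(ratSpLoc (Fp L) (n' + n') (gramD L e' dV hdV (tensorFrame L dW eW dV₀) (tensorFrame_real L dW hdW eW dV₀ hdV₀))
                (isUnit_det_gramD L e' dV hdV hdV0 (tensorFrame L dW eW dV₀) (tensorFrame_real L dW hdW eW dV₀ hdV₀) (tensorFrame_ne_zero L dW eW dV₀ hdW0 hdV₀0)) v (deltaD L),
              deltaImpl L e' dV hdV hdV0 (tensorFrame L dW eW dV₀) (tensorFrame_real L dW hdW eW dV₀ hdV₀) (tensorFrame_ne_zero L dW eW dV₀ hdW0 hdV₀0) χb (borelPlaceMeasure L) (cmFinLocalFamily L e' dV hdV hdV0 (tensorFrame L dW eW dV₀) (tensorFrame_real L dW hdW eW dV₀ hdV₀) (tensorFrame_ne_zero L dW eW dV₀ hdW0 hdV₀0) χb hχbs (borelPlaceMeasure L)) v),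
            deltaPair_mem_localMp L e' dV hdV hdV0 (tensorFrame L dW eW dV₀) (tensorFrame_real L dW hdW eW dV₀ hdV₀) (tensorFrame_ne_zero L dW eW dV₀ hdW0 hdV₀0) χb (borelPlaceMeasure L) (cmFinLocalFamily L e' dV hdV hdV0 (tensorFrame L dW eW dV₀) (tensorFrame_real L dW hdW eW dV₀ hdV₀) (tensorFrame_ne_zero L dW eW dV₀ hdW0 hdV₀0) χb hχbs (borelPlaceMeasure L)) v⟩ ⊔
        localSWImage L e dV hdV dW hdW eW e' dV₁ hdV₁ v ((finSplittings L e' dV hdV hdV0 (tensorFrame L dW eW dV₁) (tensorFrame_real L dW hdW eW dV₁ hdV₁) (tensorFrame_ne_zero L dW eW dV₁ hdW0 hdV₁0) χb (borelPlaceMeasure L) (cmFinLocalFamily L e' dV hdV hdV0 (tensorFrame L dW eW dV₁) (tensorFrame_real L dW hdW eW dV₁ hdV₁) (tensorFrame_ne_zero L dW eW dV₁ hdW0 hdV₁0) χb hχbs (borelPlaceMeasure L))).s v)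
          ⟨(ratSpLoc (Fp L) (n' + n') (gramD L e' dV hdV (tensorFrame L dW eW dV₁) (tensorFrame_real L dW hdW eW dV₁ hdV₁))
                (isUnit_det_gramD L e' dV hdV hdV0 (tensorFrame L dW eW dV₁) (tensorFrame_real L dW hdW eW dV₁ hdV₁) (tensorFrame_ne_zero L dW eW dV₁ hdW0 hdV₁0)) v (deltaD L),
              deltaImpl L e' dV hdV hdV0 (tensorFrame L dW eW dV₁) (tensorFrame_real L dW hdW eW dV₁ hdV₁) (tensorFrame_ne_zero L dW eW dV₁ hdW0 hdV₁0) χb (borelPlaceMeasure L) (cmFinLocalFamily L e' dV hdV hdV0 (tensorFrame L dW eW dV₁) (tensorFrame_real L dW hdW eW dV₁ hdV₁) (tensorFrame_ne_zero L dW eW dV₁ hdW0 hdV₁0) χb hχbs (borelPlaceMeasure L)) v),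
            deltaPair_mem_localMp L e' dV hdV hdV0 (tensorFrame L dW eW dV₁) (tensorFrame_real L dW hdW eW dV₁ hdV₁) (tensorFrame_ne_zero L dW eW dV₁ hdW0 hdV₁0) χb (borelPlaceMeasure L) (cmFinLocalFamily L e' dV hdV hdV0 (tensorFrame L dW eW dV₁) (tensorFrame_real L dW hdW eW dV₁ hdV₁) (tensorFrame_ne_zero L dW eW dV₁ hdW0 hdV₁0) χb hχbs (borelPlaceMeasure L)) v⟩ :=
  hS1ns_of_branches hS1ns_inert_of_record
    (fun L _ _ _ e dV hdV hdV0 dW hdW hdW0 _ _ eW e' dV₀ hdV₀ hdV₀0 _ hχbs v c₁ dV₁ hdV₁ hdV₁0 haV₁ hns hc₁ w₀ hw₀ hv =>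
      localDegPS_le_sup_localSWImage_ramified_of_record L e dV hdV hdV0 dW hdW hdW0 eW e' dV₀ hdV₀ hdV₀0 dV₁ hdV₁ hdV₁0 c₁ haV₁ hχbs v hns hc₁ w₀ hw₀ hv)

end Summit.HodgeConjecture.HodgeConjecture.Cruxes.HLiu418.K2LiuLocalSWSpanningNonsplitFaceOfRecord

end
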